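import Mathlib
import Summits.SmoothPoincare4.SmoothPoincare4.Theses.ConvexBisection
import Summits.SmoothPoincare4.SmoothPoincare4.Theorems.AcyclicBisectionExists.Negative.Witness
import Literature.Topology.FourManifolds.Cobordism

/-!
# Line `achiral-swap` for crux `ConvexBisection.AcyclicBisectionExists` (stmt-SmoothPoincare4-10508)

Skeleton of the line of idea card `Ideas/achiral-swap.md` (triage r1: pass ×3, merged at lever
level with `hurwitz-tilt-exchange`).  **Generation 2** (crux-plan g2): same six-stub architecture
as generation 1, with three changes —
(1) the load-bearing dictionary stub (`stub_sortDictionary`, formerly `stub_swapSort`) now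
EXPOSES the combinatorial interface of the line (the classes `Pos₁, η¹, η²` in `V = H₁(F;ℚ)` and
the two tilt coefficients `c, c'`) through two separately refutable realisability clauses, and
the composition `AcyclicBisectionExists_of` itself performs the line's characteristic step — the
case split "`[η²] ∉ span Pos₁` (sort = swap, done) / stuck (one common stabilisation pair + two
Hurwitz tilts)" — using the kernel-checked exchange lemma `tilt_linearIndependent`;
(2) the one-sided homology stub is stated over the LANDED negative-side vocabulary
`Theorems/AcyclicBisectionExists/Negative/Witness.lean` (`Negative.Witness`, `AcyclicLeft/Right`),
literally the statement of the disprover's proved `acyclicRight_of_acyclicLeft_of_homotopyEquiv'`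
(Disproof.lean §9), so it closes by `exact` when that part of the Negative split lands;
(3) Disproof v7 (§10b, §11) and the landed Negative lemmas are honoured (see below).

## The line in one paragraph

Start from the Akbulut–Matveyev FOLDED decomposition of the homotopy sphere `M = X̃₁ ∪ X̃₂`
(`X̃₁` contractible Stein, `-X̃₂` Stein and ℤ-acyclic, seam `Γ` a ℤHS³; arXiv:math/0010166 Thm 3 +
Cor 1) — `stub_akbulutMatveyevFolded`.  The two Stein contact structures on `Γ` are positive for the
SAME orientation (folded) and HOMOTOPIC as plane fields (`d₃ = -1/2` from either ℚ-acyclic Stein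
side, `H²(Γ) = 0`; Gompf 1998 Thm 4.16) — `stub_seamFieldsHomotopic`.  Hence ONE negative open-book
stabilisation on each side (an achiral Lefschetz 1–2 pair inside the piece, pieces unchanged) makes
both overtwisted and still homotopic, hence isotopic (Eliashberg), hence commonly positively
stabilisable (Giroux): `M` becomes a MATCHED pair of allowable achiral Lefschetz fibrations over one
open book `(F, φ)` with exactly ONE letter of the wrong chirality on each side (`η¹` on side 1, `η²`
on side 2), side 1's classes `Pos₁ ∪ {η¹}` a ℚ-basis of `V = H₁(F;ℚ)`.  Baykur's chirality sorting
(arXiv:math/0601396 §5, proof of Thm 5.1, M-positive arcs unmodified) re-splits `M = X₊ ∪ X₋` with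
`X₊ = PALF(F; Pos₁, η²)` — `X̃₁` with its achiral handle SWAPPED for `X̃₂`'s — both halves allowable
PALFs (for `M` resp. `-M`), hence Stein (Akbulut–Ozbagci / Loi–Piergallini) with both boundary
contact structures supported by the ONE open book `(F, φ₊)` of the new seam; `X₊` is ℚ-acyclic iff
`Pos₁ ∪ {η²}` is linearly independent — one determinant.  If it vanishes, ONE common positive
stabilisation pair `u₁, u₂` and two Hurwitz tilts (`u₁ ↦ u₁ - cη¹` on side 1, `η² ↦ η² + c'u₁` on
side 2, `c, c' ≠ 0` the intersection numbers of the stabilisation arc with `η¹, η²`) make the new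
M-positive family `Pos₁ ∪ {u₁ - cη¹, u₂, η² + c'u₁}` a basis of `H₁(F';ℚ) = V ⊕ ℚu₁ ⊕ ℚu₂`
(`tilt_linearIndependent`, PROVED here) and the same sorting applies.  This dictionary —
realisation of the sorted configuration as a Stein bisection with common supporting open book, in
the unstuck and in the tilted configuration — is `stub_sortDictionary` (the load-bearing stub).  Two
positive contact structures supported by one open book with the same orientation are isotopic
(Giroux–Torisu uniqueness + Gray) — `stub_girouxUniqueness`; the isotopy is absorbed into the Stein
structure of `W₁` by a collar pull-back — `stub_realiseSeamIsotopy`; and over a homotopy 4-sphere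
ℚ-acyclicity of the connected half `W₁` forces that of `W₂` — `stub_acyclicRightOfLeft` (the
disprover's theorem).  `AcyclicBisectionExists_of` composes the six stubs into the crux BY NAME.

## Typing policy

The tree has no Lefschetz-fibration / mapping-class / open-book-stabilisation vocabulary (idea
card D1, re-checked 2026-08-16: `lean search --decl
'LefschetzFibration|Stabili[sz]ation|OpenBook|PALF|DehnTwist|Hurwitz'` → Hard-Lefschetz (Hodge),
`OpenBook` of `PlanarContactBoundary.lean`, the `S² × S²`-stabilisation barrier facts, Hurwitz
matrices — nothing else), so
the skeleton is cut exactly at the interfaces that ARE typable over existing declarations: Stein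
bisections (`SteinStructure`, `contactPlane`, `Manifold.IsSmoothEmbedding`), the fold condition
(sign of `α ∧ dα` on matched boundary frames), homotopies of plane fields (a smooth 1-form on
`ℝ × ∂X₁`), open books and Giroux forms on a boundary datum (`OpenBook`, `OpenBook.IsGirouxForm`,
`boundaryPlaneField`, `BoundaryData`), isotopies (`Diffeomorph`, `ContMDiff`), rational singular
homology, the landed `Negative.Witness`, and — new in gen 2 — the LINEAR-ALGEBRA SHADOW of the
matched presentation (`V`, `Pos₁ : Fin d → V`, `η¹ η² : V`, `c c' : ℚ`, `tiltFamily`).  The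
auxiliary `def`s below are transparent abbreviations; none is an opaque predicate.  All
Lefschetz-fibration mathematics lives INSIDE `stub_sortDictionary`, whose two realisability
clauses are its checkable surface.

## Disproof used (`Cruxes/AcyclicBisectionExists/Disproof.lean`, cdisprove gen 2 v7, read 2026-08-16)

* `acyclicBisectionExists_false_without_homotopyEquiv` (§3; LANDED as
  `Negative.acyclicBisectionExists_false_without_homotopyEquiv`): any proof must use `M ≃ₕ S⁴` —
  the line uses it in `stub_akbulutMatveyevFolded` (AM Cor 1 needs `π₁ = 1` for a contractible
  `X̃₁`; Alexander duality in the homology sphere for the acyclic `X̃₂`) and in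
  `stub_acyclicRightOfLeft`; no stub asserts a bisection of an `M` without hypotheses.
* `not_acyclicBisectionExistsAllDegrees` (§4; LANDED): the guard `0 < k` is load-bearing —
  `RatAcyclic` and `Negative.Witness.AcyclicLeft/Right` keep it.
* `not_acyclicBisectionExistsForSimplyConnectedClosed` (§7, ℂP²): `stub_sortDictionary` asks BOTH
  input pieces to be ℚ-acyclic (`X₁` contractible, `X₂` ℚ-acyclic) — for ℂP² no folded Stein pair
  has that (`b₂ = 1` must sit in a piece), so the stub is not an instance of the refuted weakening.
* §8–§9 `Witness.acyclicRight_of_acyclicLeft_of_homotopyEquiv'`: IS `stub_acyclicRightOfLeft`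
  (stated over the landed `Negative.Witness`; false without `ConnectedSpace W₁`, which
  `SortedBisection` therefore delivers).
* §10b `connectedSpace₁_of_acyclic` (both halves of an ACYCLIC witness are automatically connected)
  is not usable here (it presupposes both halves acyclic); §10 `acyclic_iff_seam_of_homotopyEquiv`
  is the crux text's gloss, not needed by the line.
* §11 `hasAcyclicSteinBisection_sphere`, `acyclicBisectionExists_of_spc4`,
  `exotic_of_not_acyclicBisectionExists`: tightness and the formal kill criterion — consistent with
  the line (at `M = S⁴` the AM pair is `B⁴ ∪ B⁴`, `F` = annulus after the `n = 1` matching,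
  `Pos₁ = ∅`, `η¹ = η² = core`: unstuck, `X₊ = PALF(annulus; core) = B⁴`, seam `S³`).
* junk models (§1–§2 `hasAcyclicSteinBisection_of_isEmpty`, `seam_nonempty`, `halves_nonempty`):
  every piece here is a nonempty compact Stein 2-handlebody; nothing is claimed over empty `M`.
Landed Negative modules checked against (imported / scratch-checked with this file):
`Theorems/AcyclicBisectionExists/Negative/Witness.lean` (p70455), `Negative/Gluing.lean` (p70736) —
neither refutes an instance of any stub (they are structure lemmas plus the two refutations above).
Negatives index for SmoothPoincare4: 0 refuted route statements (`ledger negatives`, 2026-08-16).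
-/

noncomputable section

-- the prescribed namespace `Summit.<P>.<Sub>.…` duplicates `SmoothPoincare4` (P = Sub)
set_option linter.dupNamespace false

open scoped Manifold ContDiff Topology ContinuousMap
open Set Function CategoryTheory
open Literature.Geometry.Symplectic Literature.Topology.FourManifolds
open Literature.AlgebraicTopology.SingularHomology

namespace Summit.SmoothPoincare4.SmoothPoincare4.Cruxes.AcyclicBisectionExists.AchiralSwap

/-! ### Transparent abbreviations (conjuncts of the crux and the typable interfaces) -/

/-- The first five conjuncts of the crux: `M = e₁(W₁) ∪ e₂(W₂)`, two compact 4-manifolds with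
boundary smoothly embedded, covering `M`, meeting exactly along the images of their boundaries. -/
def IsBisection (M : Type) [TopologicalSpace M] [ChartedSpace (EuclideanSpace ℝ (Fin 4)) M]
    (W₁ : Type) [TopologicalSpace W₁] [ChartedSpace (EuclideanHalfSpace 4) W₁]
    (W₂ : Type) [TopologicalSpace W₂] [ChartedSpace (EuclideanHalfSpace 4) W₂]
    (e₁ : W₁ → M) (e₂ : W₂ → M) : Prop :=
  Manifold.IsSmoothEmbedding (𝓡∂ 4) (𝓡 4) ∞ e₁ ∧ Manifold.IsSmoothEmbedding (𝓡∂ 4) (𝓡 4) ∞ e₂ ∧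
    Set.range e₁ ∪ Set.range e₂ = Set.univ ∧
    Set.range e₁ ∩ Set.range e₂ = e₁ '' (𝓡∂ 4).boundary W₁ ∧
    Set.range e₁ ∩ Set.range e₂ = e₂ '' (𝓡∂ 4).boundary W₂

/-- The sixth conjunct of the crux: the complex tangencies of the two Stein structures push
forward to the SAME plane at every seam point. -/
def PlanesMatch (M : Type) [TopologicalSpace M] [ChartedSpace (EuclideanSpace ℝ (Fin 4)) M]
    (W₁ : Type) [TopologicalSpace W₁] [ChartedSpace (EuclideanHalfSpace 4) W₁]
    [IsManifold (𝓡∂ 4) ∞ W₁] [CompactSpace W₁]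
    (W₂ : Type) [TopologicalSpace W₂] [ChartedSpace (EuclideanHalfSpace 4) W₂]
    [IsManifold (𝓡∂ 4) ∞ W₂] [CompactSpace W₂]
    (J₁ : SteinStructure W₁) (J₂ : SteinStructure W₂) (e₁ : W₁ → M) (e₂ : W₂ → M) : Prop :=
  ∀ w₁ w₂, e₁ w₁ = e₂ w₂ →
    Submodule.map (mfderiv (𝓡∂ 4) (𝓡 4) e₁ w₁).toLinearMap (contactPlane J₁.J w₁) =
      Submodule.map (mfderiv (𝓡∂ 4) (𝓡 4) e₂ w₂).toLinearMap (contactPlane J₂.J w₂)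

/-- Rational acyclicity in positive degrees (the crux's last conjunct, one half at a time; the
degree guard `0 < k` is load-bearing: landed `Negative.not_acyclicBisectionExistsAllDegrees`). -/
def RatAcyclic (W : Type) [TopologicalSpace W] : Prop :=
  ∀ k, 0 < k → CategoryTheory.Limits.IsZero (singularHomology ℚ ℚ W k)

/-- `(α ∧ dα)(u, v, w)` for the contact form `α = -d^ℂφ` of a Stein structure (`contactForm`) and
its differential `dα = -dd^ℂφ` (`kahlerForm`), on three tangent vectors at `x` (meaningful on
`T_x∂W`, where its sign is the contact orientation = the boundary orientation of the complex
orientation: `(α ∧ dα)(Jn, v, Jv) = dφ(n) · ω(v, Jv) > 0` for the outward normal `n`, `v ∈ ξ`). -/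
def boundaryVolume {W : Type} [TopologicalSpace W] [ChartedSpace (EuclideanHalfSpace 4) W]
    [IsManifold (𝓡∂ 4) ∞ W] [CompactSpace W] (S : SteinStructure W) (x : W)
    (u v w : EuclideanSpace ℝ (Fin 4)) : ℝ :=
  S.contactForm x u * S.kahlerForm x v w - S.contactForm x v * S.kahlerForm x u w +
    S.contactForm x w * S.kahlerForm x u v

/-- **The fold condition** ("`X̃₁` and `-X̃₂` are Stein", Akbulut–Matveyev p. 4: *"`X₁` and `-X₂`
induce the same orientation on their common boundary"*), stated without orienting anything: at a
seam point, whenever a boundary frame `(u, v, w)` of `X₁` and a boundary frame `(u', v', w')` of `X₂`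
push forward to the same frame of `M`, the two contact orientations `α₁ ∧ dα₁`, `α₂ ∧ dα₂` give
them the same sign.  (Equality of the pushed-forward contact planes, as in the crux, forces this.) -/
def SameSeamOrientation (M : Type) [TopologicalSpace M] [ChartedSpace (EuclideanSpace ℝ (Fin 4)) M]
    (X₁ : Type) [TopologicalSpace X₁] [ChartedSpace (EuclideanHalfSpace 4) X₁]
    [IsManifold (𝓡∂ 4) ∞ X₁] [CompactSpace X₁]
    (X₂ : Type) [TopologicalSpace X₂] [ChartedSpace (EuclideanHalfSpace 4) X₂]
    [IsManifold (𝓡∂ 4) ∞ X₂] [CompactSpace X₂]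
    (I₁ : SteinStructure X₁) (I₂ : SteinStructure X₂) (f₁ : X₁ → M) (f₂ : X₂ → M) : Prop :=
  ∀ x₁ x₂, f₁ x₁ = f₂ x₂ → ∀ u v w u' v' w' : EuclideanSpace ℝ (Fin 4),
    u ∈ boundaryTangentSpace → v ∈ boundaryTangentSpace → w ∈ boundaryTangentSpace →
    u' ∈ boundaryTangentSpace → v' ∈ boundaryTangentSpace → w' ∈ boundaryTangentSpace →
    mfderiv (𝓡∂ 4) (𝓡 4) f₁ x₁ u = mfderiv (𝓡∂ 4) (𝓡 4) f₂ x₂ u' →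
    mfderiv (𝓡∂ 4) (𝓡 4) f₁ x₁ v = mfderiv (𝓡∂ 4) (𝓡 4) f₂ x₂ v' →
    mfderiv (𝓡∂ 4) (𝓡 4) f₁ x₁ w = mfderiv (𝓡∂ 4) (𝓡 4) f₂ x₂ w' →
    0 ≤ boundaryVolume I₁ x₁ u v w * boundaryVolume I₂ x₂ u' v' w'

/-- **The other side's contact planes, read on a boundary datum of `W₁`.**  For `y` in the
boundary 3-manifold `b.carrier ≅ ∂W₁`, the plane of vectors `v ∈ T_y b.carrier = ℝ³` whose image
under `d(e₁ ∘ b.incl)` lies in the push-forward `de₂(ξ₂(w₂))` of the complex tangencies of `J₂` at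
the point `w₂` of `W₂` over `e₁ (b.incl y)` (there is exactly one such `w₂` at a seam point of a
bisection; the `⨆` is over that point). -/
def seamPlaneField {M : Type} [TopologicalSpace M] [ChartedSpace (EuclideanSpace ℝ (Fin 4)) M]
    {W₁ : Type} [TopologicalSpace W₁] [ChartedSpace (EuclideanHalfSpace 4) W₁]
    {W₂ : Type} [TopologicalSpace W₂] [ChartedSpace (EuclideanHalfSpace 4) W₂]
    (J₂ : (x : W₂) → (EuclideanSpace ℝ (Fin 4) →L[ℝ] EuclideanSpace ℝ (Fin 4)))
    (e₁ : W₁ → M) (e₂ : W₂ → M) (b : BoundaryData (𝓡∂ 4) W₁ (𝓡 3)) (y : b.carrier) :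
    Submodule ℝ (EuclideanSpace ℝ (Fin 3)) :=
  ⨆ (w₂ : W₂) (_ : e₂ w₂ = e₁ (b.incl y)),
    ((contactPlane J₂ w₂).map (mfderiv (𝓡∂ 4) (𝓡 4) e₂ w₂).toLinearMap).comap
      ((mfderiv (𝓡∂ 4) (𝓡 4) e₁ (b.incl y)).toLinearMap ∘ₗ
        (mfderiv (𝓡 3) (𝓡∂ 4) b.incl y).toLinearMap)

/-- **Homotopy of (co-orientable) plane fields on a 3-manifold `N`**: a smooth 1-form `A` on `ℝ × N`
which is nowhere zero on the `N`-directions and cuts out `ξ` at time `0` and `ξ'` at time `1`.  The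
co-orientations at the two ends are NOT prescribed (only the kernels): on a ℤ-homology-sphere seam —
the only case in which the line uses it, `X₁` contractible — a co-oriented plane field is homotopic
to its reverse (the Pontryagin/Hopf invariant is multiplied by `deg(antipodal)² = 1`), so nothing
is lost. -/
def PlaneFieldsHomotopic {N : Type} [TopologicalSpace N] [ChartedSpace (EuclideanSpace ℝ (Fin 3)) N]
    (ξ ξ' : N → Submodule ℝ (EuclideanSpace ℝ (Fin 3))) : Prop :=
  ∃ A : Literature.Geometry.Kaehler.MForm (𝓘(ℝ, ℝ).prod (𝓡 3)) (ℝ × N) ℝ 1,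
    Literature.Geometry.Kaehler.IsSmoothForm A ∧
    (∀ (t : ℝ) (y : N), ∃ v : EuclideanSpace ℝ (Fin 3), A (t, y) ![((0 : ℝ), v)] ≠ 0) ∧
    (∀ (y : N) (v : EuclideanSpace ℝ (Fin 3)), v ∈ ξ y ↔ A (0, y) ![((0 : ℝ), v)] = 0) ∧
    (∀ (y : N) (v : EuclideanSpace ℝ (Fin 3)), v ∈ ξ' y ↔ A (1, y) ![((0 : ℝ), v)] = 0)

/-- Two contact forms on a 3-manifold induce the SAME orientation: `α ∧ dα` and `α' ∧ dα'` have
the same sign on every frame (`wedge₁₂` of `PlanarContactBoundary.lean`). -/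
def SameContactOrientation {N : Type} [TopologicalSpace N]
    [ChartedSpace (EuclideanSpace ℝ (Fin 3)) N]
    (α α' : Literature.Geometry.Kaehler.MForm (𝓡 3) N ℝ 1) : Prop :=
  ∀ (y : N) (u v w : EuclideanSpace ℝ (Fin 3)),
    0 ≤ wedge₁₂ (α y) (Literature.Geometry.Kaehler.mextDeriv α y) u v w *
      wedge₁₂ (α' y) (Literature.Geometry.Kaehler.mextDeriv α' y) u v w

/-- A smooth isotopy of a 3-manifold starting at the identity: a family of diffeomorphisms
`F t`, jointly `C^∞` in `(t, y)`, with `F 0 = id`. -/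
def IsSmoothIsotopy {N : Type} [TopologicalSpace N] [ChartedSpace (EuclideanSpace ℝ (Fin 3)) N]
    (F : ℝ → N ≃ₘ⟮𝓡 3, 𝓡 3⟯ N) : Prop :=
  (∀ y, F 0 y = y) ∧ ContMDiff (𝓘(ℝ, ℝ).prod (𝓡 3)) (𝓡 3) ∞ (fun p : ℝ × N => F p.1 p.2)

/-- The diffeomorphism `ψ` carries the plane field `ξ` onto `ξ'`: `dψ_y(ξ_y) = ξ'_{ψ y}`. -/
def PushesTo {N : Type} [TopologicalSpace N] [ChartedSpace (EuclideanSpace ℝ (Fin 3)) N]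
    (ψ : N ≃ₘ⟮𝓡 3, 𝓡 3⟯ N) (ξ ξ' : N → Submodule ℝ (EuclideanSpace ℝ (Fin 3))) : Prop :=
  ∀ y, (ξ y).map (mfderiv (𝓡 3) (𝓡 3) ψ y).toLinearMap = ξ' (ψ y)

/-- **The output of the sort** (the interface between the dictionary and the matching stubs): a
bisection `W₁ ∪ W₂` of `M` into compact Stein domains with `W₁` Hausdorff, CONNECTED and
ℚ-ACYCLIC, together with ONE open book `ob` on a boundary datum `b'` of `W₁` and Giroux forms for
BOTH the `J₁`-tangencies of `∂W₁` and the `J₂`-tangencies read through the seam, positive for the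
same orientation (the configuration is still folded).  On paper: `W₁ = X₊ = PALF(F; M-positive
letters)`, `-W₂ = PALF(F; conjugated M-negative letters)`, `ob = OB(F, φ₊)`. -/
def SortedBisection (M : Type) [TopologicalSpace M] [ChartedSpace (EuclideanSpace ℝ (Fin 4)) M] :
    Prop :=
  ∃ (W₁ : Type) (_ : TopologicalSpace W₁) (_ : T2Space W₁)
    (_ : ChartedSpace (EuclideanHalfSpace 4) W₁) (_ : IsManifold (𝓡∂ 4) ∞ W₁)
    (_ : CompactSpace W₁) (_ : ConnectedSpace W₁)
    (W₂ : Type) (_ : TopologicalSpace W₂) (_ : ChartedSpace (EuclideanHalfSpace 4) W₂)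
    (_ : IsManifold (𝓡∂ 4) ∞ W₂) (_ : CompactSpace W₂)
    (J₁ : SteinStructure W₁) (J₂ : SteinStructure W₂) (e₁ : W₁ → M) (e₂ : W₂ → M)
    (b' : BoundaryData (𝓡∂ 4) W₁ (𝓡 3)) (ob : OpenBook b'.carrier)
    (α₁ α₂ : Literature.Geometry.Kaehler.MForm (𝓡 3) b'.carrier ℝ 1),
    IsBisection M W₁ W₂ e₁ e₂ ∧ RatAcyclic W₁ ∧
    ob.IsGirouxForm (boundaryPlaneField J₁.J b') α₁ ∧
    ob.IsGirouxForm (seamPlaneField J₂.J e₁ e₂ b') α₂ ∧ SameContactOrientation α₁ α₂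

/-! ### The algebraic core of the swap (proved): the one-step exchange at `n = 1`

After the `n = 1` matching, side 1 is `ALF(F; Pos₁, η¹)` with `Pos₁ ∪ {η¹}` a ℚ-basis of
`V = H₁(F;ℚ)` (`X̃₁` contractible), and the sorted positive half is `X₊ = PALF(F; Pos₁, η²)`, which
is ℚ-acyclic iff `Pos₁ ∪ {η²}` is again a basis — iff `[η²] ∉ U := span Pos₁`.  If stuck
(`[η²] ∈ U`), ONE common positive stabilisation PAIR `u₁, u₂` (`H₁(F';ℚ) = V ⊕ ℚu₁ ⊕ ℚu₂`; side 1
receives `u₁⁺ u₂⁺`, side 2 the same curves as `M`-negative letters) and two Hurwitz tilts —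
`u₁ ↦ u₁ - c η¹` on side 1 and `η² ↦ η² + c' u₁` on side 2, `c = ±(γ₁ · η¹) ≠ 0`,
`c' = ±(γ₁ · η²) ≠ 0` for the stabilisation arc `γ₁` — make the new `M`-positive family
`Pos₁ ∪ {u₁ - cη¹, u₂, η² + c'u₁}` (`tiltFamily`) a basis of `H₁(F';ℚ)` (`tilt_linearIndependent`,
the cons-family form used by the composition; generation 1's `swap_exchange` — the same count
modulo `U`, TRIAGE-r1-2's "3-line coefficient count" — is subsumed by it).  Realising `γ₁`, the
legality of the moves and the identification of the sorted pieces are the geometric content of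
`stub_sortDictionary`. -/

section TiltAlgebra

variable {K V : Type*} [Field K] [AddCommGroup V] [Module K V] {d : ℕ}

/-- The classes of the OLD `M`-positive letters `Pos₁` in `H₁(F';ℚ) = V ⊕ Ku₁ ⊕ Ku₂`
(curves in `F ⊂ F'`). -/
def oldFamily (P : Fin d → V) : Fin d → V × K × K := fun i => (P i, 0, 0)

/-- **The tilted `M`-positive family** after one common positive stabilisation pair and the two
Hurwitz tilts, as classes in `H₁(F';ℚ) = V × K × K` (coordinates `(old, u₁, u₂)`):
`u₁ - c η¹ = (-c η¹, 1, 0)`, `u₂ = (0, 0, 1)`, `η² + c' u₁ = (η², c', 0)`, then `Pos₁`. -/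
def tiltFamily (P : Fin d → V) (η₁ η₂ : V) (c c' : K) : Fin (d + 3) → V × K × K :=
  (Fin.cons ((-c) • η₁, 1, 0)
    (Fin.cons ((0 : V), (0 : K), (1 : K))
      (Fin.cons (η₂, c', 0) (oldFamily P) : Fin (d + 1) → V × K × K) :
        Fin (d + 2) → V × K × K) : Fin (d + 3) → V × K × K)

/-- The old classes span at most `span Pos₁ ⊕ 0 ⊕ 0`. -/
theorem span_oldFamily_le (P : Fin d → V) :
    Submodule.span K (Set.range (oldFamily (K := K) P)) ≤
      (Submodule.span K (Set.range P)).prod ⊥ := by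
  refine Submodule.span_le.2 ?_
  rintro _ ⟨i, rfl⟩
  exact ⟨Submodule.subset_span ⟨i, rfl⟩, (Submodule.mem_bot K).2 rfl⟩

/-- The old classes are linearly independent when `Pos₁` is. -/
theorem linearIndependent_oldFamily {P : Fin d → V} (hP : LinearIndependent K P) :
    LinearIndependent K (oldFamily (K := K) P) :=
  LinearIndependent.of_comp (LinearMap.fst K V (K × K)) hP

/-- **Exchange lemma, cons-family form (used by the composition).**  If `Pos₁ ∪ {η¹}` is linearly
independent, `Pos₁ ∪ {η²}` is NOT (the stuck case: `[η²] ∈ span Pos₁`), and `c, c' ≠ 0`, then the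
tilted `M`-positive family is linearly independent in `V × K × K`. -/
theorem tilt_linearIndependent (P : Fin d → V) (η₁ η₂ : V) (c c' : K)
    (hbasis : LinearIndependent K (Fin.cons η₁ P : Fin (d + 1) → V))
    (hstuck : ¬ LinearIndependent K (Fin.cons η₂ P : Fin (d + 1) → V))
    (hc : c ≠ 0) (hc' : c' ≠ 0) :
    LinearIndependent K (tiltFamily P η₁ η₂ c c') := by
  have hP : LinearIndependent K P := (linearIndependent_finCons.1 hbasis).1
  have hη₁ : η₁ ∉ Submodule.span K (Set.range P) := (linearIndependent_finCons.1 hbasis).2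
  have hη₂ : η₂ ∈ Submodule.span K (Set.range P) := by
    by_contra h
    exact hstuck (linearIndependent_finCons.2 ⟨hP, h⟩)
  -- level 0: the old classes
  have h0 : LinearIndependent K (oldFamily (K := K) P) := linearIndependent_oldFamily hP
  -- level 1: add `η² + c' u₁ = (η², c', 0)` — independent because `c' ≠ 0`
  have h1 : LinearIndependent K (Fin.cons (η₂, c', 0) (oldFamily P) : Fin (d + 1) → V × K × K) := by
    refine linearIndependent_finCons.2 ⟨h0, fun hmem => hc' ?_⟩
    have h2 := ((Submodule.mem_prod).1 (span_oldFamily_le P hmem)).2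
    rw [Submodule.mem_bot] at h2
    exact congrArg Prod.fst h2
  -- level 2: add `u₂ = (0, 0, 1)` — independent because all previous classes have no `u₂`-part
  have hle2 : Submodule.span K (Set.range
      (Fin.cons (η₂, c', 0) (oldFamily P) : Fin (d + 1) → V × K × K)) ≤
      (⊤ : Submodule K V).prod ((⊤ : Submodule K K).prod ⊥) := by
    refine Submodule.span_le.2 ?_
    rw [Fin.range_cons, Set.insert_subset_iff]
    refine ⟨⟨trivial, trivial, (Submodule.mem_bot K).2 rfl⟩, ?_⟩
    rintro _ ⟨i, rfl⟩
    exact ⟨trivial, trivial, (Submodule.mem_bot K).2 rfl⟩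
  have h2 : LinearIndependent K (Fin.cons ((0 : V), (0 : K), (1 : K))
      (Fin.cons (η₂, c', 0) (oldFamily P) : Fin (d + 1) → V × K × K) :
        Fin (d + 2) → V × K × K) := by
    refine linearIndependent_finCons.2 ⟨h1, fun hmem => ?_⟩
    have h3 := ((Submodule.mem_prod).1 ((Submodule.mem_prod).1 (hle2 hmem)).2).2
    rw [Submodule.mem_bot] at h3
    exact one_ne_zero (h3 : (1 : K) = 0)
  -- level 3: add `u₁ - c η¹ = (-c η¹, 1, 0)` — independent because `η¹ ∉ span Pos₁ ∋ η²`, `c ≠ 0`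
  have hle3 : Submodule.span K (Set.range (Fin.cons ((0 : V), (0 : K), (1 : K))
      (Fin.cons (η₂, c', 0) (oldFamily P) : Fin (d + 1) → V × K × K) :
        Fin (d + 2) → V × K × K)) ≤ (Submodule.span K (Set.range P)).prod ⊤ := by
    refine Submodule.span_le.2 ?_
    rw [Fin.range_cons, Set.insert_subset_iff, Fin.range_cons, Set.insert_subset_iff]
    refine ⟨⟨Submodule.zero_mem _, trivial⟩, ⟨hη₂, trivial⟩, ?_⟩
    rintro _ ⟨i, rfl⟩
    exact ⟨Submodule.subset_span ⟨i, rfl⟩, trivial⟩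
  unfold tiltFamily
  refine linearIndependent_finCons.2 ⟨h2, fun hmem => hη₁ ?_⟩
  have h4 : (-c) • η₁ ∈ Submodule.span K (Set.range P) :=
    ((Submodule.mem_prod).1 (hle3 hmem)).1
  exact (Submodule.smul_mem_iff _ (neg_ne_zero.2 hc)).1 h4

end TiltAlgebra

/-! ### The stubs -/

/-- **stub 1 — Akbulut–Matveyev, folded, with homotopy control** (arXiv:math/0010166 Thm 3 (= "Thm 4
(3)") + Cor 1, pp. 3–4; size XL as a vendored fact, the tree's `akbulut_matveyev` forgets exactly the
two things needed here: orientation and homotopy type).  Every homotopy 4-sphere `M` is a bisection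
`M = f₁(X₁) ∪ f₂(X₂)` into two compact Stein domains with `X₁` CONTRACTIBLE (Cor 1: `X₁ = Y₁ ∪ {hᵢ}`
made contractible using `π₁(M) = 1`, then Thm 3 keeps the homotopy type), `X₂` connected and
ℚ-acyclic (`X₂ ≃ M ∖ X₁°`, Alexander duality in the homology sphere — this is where `M ≃ₕ S⁴` is
used: landed `Negative.acyclicBisectionExists_false_without_homotopyEquiv`), and FOLDED: `X₁` and
`-X₂` are Stein, i.e. the two contact orientations agree across the seam (`SameSeamOrientation`; AM
p. 4, confirmed by all three triagers).  Why plausibly true: it is the printed theorem plus Alexander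
duality.  Leans on: `SteinStructure`, `Gompf1998_thm13_twoHandles`, `Gompf1998_thm13_noTwoHandles`,
`akbulut_matveyev_of_thm3'`, `HandleAttachingMap`, `IsHandlebodyOfIndexLE`. -/
theorem stub_akbulutMatveyevFolded :
    ∀ (M : Type) [TopologicalSpace M] [T2Space M] [SecondCountableTopology M]
      [ChartedSpace (EuclideanSpace ℝ (Fin 4)) M] [IsManifold (𝓡 4) ∞ M],
      M ≃ₕ Metric.sphere (0 : EuclideanSpace ℝ (Fin 5)) 1 →
      ∃ (X₁ : Type) (_ : TopologicalSpace X₁) (_ : T2Space X₁)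
        (_ : ChartedSpace (EuclideanHalfSpace 4) X₁) (_ : IsManifold (𝓡∂ 4) ∞ X₁)
        (_ : CompactSpace X₁) (_ : ContractibleSpace X₁)
        (X₂ : Type) (_ : TopologicalSpace X₂) (_ : T2Space X₂)
        (_ : ChartedSpace (EuclideanHalfSpace 4) X₂) (_ : IsManifold (𝓡∂ 4) ∞ X₂)
        (_ : CompactSpace X₂) (_ : ConnectedSpace X₂)
        (I₁ : SteinStructure X₁) (I₂ : SteinStructure X₂) (f₁ : X₁ → M) (f₂ : X₂ → M),
        IsBisection M X₁ X₂ f₁ f₂ ∧ RatAcyclic X₂ ∧ SameSeamOrientation M X₁ X₂ I₁ I₂ f₁ f₂ := by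
  sorry

/-- **stub 2 — the seam contact structures of a folded acyclic pair are homotopic plane fields**
(Akbulut–Matveyev §6, parenthetical to Q1: "contact structures on `∂X̃₁` and `∂(-X̃₂)` can be made
homotopic" — here automatic; Gompf arXiv:math/9803019 Thm 4.16 + the filling formula
`d₃(ξ) = (c₁² - 3σ - 2χ)/4`; size L–XL in Lean: Pontryagin/Hopf classification of plane fields on a
3-manifold).  For a folded bisection with `X₁` contractible and `X₂` ℚ-acyclic: the seam
`Γ = ∂X₁` is a ℤHS³ (`X₁` contractible), both fillings have `c₁² = σ = 0`, `χ = 1`, so both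
contact structures have `d₃ = -1/2` FOR THE SAME ORIENTATION of `Γ` (the fold); on a ℤHS the
2-dimensional obstruction vanishes, so they are homotopic as plane fields on the boundary datum `b`
of `X₁` (the second one read through the seam, `seamPlaneField`).  This is the `d₃`-"Euler balance"
of the card: it is what pins ONE negative stabilisation per side (`n = 1`) in `stub_sortDictionary`
(each negative Hopf stabilisation is `# ξ_{H⁻}`, shifting `d₃` by `+1` on both sides, Torisu / DGS
Cor 3.6).  Why it might fail: only through an orientation/sign slip in `SameSeamOrientation` (the
fold is essential: positive structures for opposite orientations are never comparable). -/
theorem stub_seamFieldsHomotopic :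
    ∀ (M : Type) [TopologicalSpace M] [T2Space M] [SecondCountableTopology M]
      [ChartedSpace (EuclideanSpace ℝ (Fin 4)) M] [IsManifold (𝓡 4) ∞ M]
      (X₁ : Type) [TopologicalSpace X₁] [T2Space X₁] [ChartedSpace (EuclideanHalfSpace 4) X₁]
      [IsManifold (𝓡∂ 4) ∞ X₁] [CompactSpace X₁] [ContractibleSpace X₁]
      (X₂ : Type) [TopologicalSpace X₂] [T2Space X₂] [ChartedSpace (EuclideanHalfSpace 4) X₂]
      [IsManifold (𝓡∂ 4) ∞ X₂] [CompactSpace X₂] [ConnectedSpace X₂]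
      (I₁ : SteinStructure X₁) (I₂ : SteinStructure X₂) (f₁ : X₁ → M) (f₂ : X₂ → M),
      IsBisection M X₁ X₂ f₁ f₂ → RatAcyclic X₂ → SameSeamOrientation M X₁ X₂ I₁ I₂ f₁ f₂ →
      ∀ b : BoundaryData (𝓡∂ 4) X₁ (𝓡 3),
        PlaneFieldsHomotopic (boundaryPlaneField I₁.J b) (seamPlaneField I₂.J f₁ f₂ b) := by
  sorry

/-- **stub 3 (load-bearing, hardest) — the sorting dictionary: from a folded Stein pair (`X₁`
contractible, `X₂` ℚ-acyclic) with homotopic seam structures to the LINEAR-ALGEBRA SHADOW of a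
matched `n = 1` presentation, together with the REALISATION of its two sorted configurations as
Stein bisections with a common supporting open book.**  Size XL (a vendoring composite; every
step but the class bookkeeping is a printed theorem, re-derived by the three triagers):
(i) each piece is an allowable PALF for its Stein structure with boundary open book supporting it
(Akbulut–Ozbagci arXiv:math/0012239 / Loi–Piergallini arXiv:math/0002042);
(ii) `n = 1` MATCHING: by the fold and `PlaneFieldsHomotopic`, ONE negative Hopf stabilisation of
each boundary open book (an achiral Lefschetz 1–2 pair inside the piece; pieces and `M` unchanged;
Harer / Etnyre–Fuller arXiv:math/0510008 §3) makes both seam structures overtwisted and still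
homotopic, hence isotopic (Eliashberg 1989, Thm 1.6.1), hence after common POSITIVE stabilisations
(Giroux 2002; proofs arXiv:2307.02317) and a regluing by a diffeomorphism isotopic to the identity,
the two sides are achiral Lefschetz fibrations over ONE open book `(F, φ)` of the seam: side 1 =
`ALF(F; Pos₁, η¹)` (`η¹` the only `M`-negative letter, walked to the right end by Hurwitz moves that
conjugate the mover, so `Pos₁`'s curves are untouched), side 2 (for `-X̃₂`) with exactly one
`M`-positive letter `η²` (walked to the right end by moves conjugating the PASSED letters, so `η²`'s
curve is untouched); `V := H₁(F;ℚ)`, `d + 1 := dim V`, `P := [Pos₁] : Fin d → V`, `η₁ := [η¹]`,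
`η₂ := [η²]`; `Fin.cons η₁ P` is a BASIS of `V` (`X̃₁` contractible: `d + 1` letters, `b₁ = 0`);
choose a properly embedded arc `γ₁ ⊂ F` with `c := ∓(γ₁ · η¹) ≠ 0`, `c' := ±(γ₁ · η²) ≠ 0` (both
classes are non-zero; a primitive class of `H₁(F, ∂F)` pairing non-trivially with both is one arc);
(iii) SORT = SWAP, unstuck clause (Baykur arXiv:math/0601396 proof of Thm 5.1, pp. 12–13, Remark 4;
fold identity `M = Z ∪ (∂F × D³)`, `Z → S²` the bounded-fibre ALF; any disc `D₊ ⊃` the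
`M`-positive critical values, `M`-positive arcs unmodified, conjugations on the `M`-negative
letters): `M = X₊ ∪ X₋`, `X₊ = PALF(F; Pos₁, η²)`, `-X₋ = PALF(F; conjugates of η¹ and of side 2's
other letters)`; all letters non-zero in `H₁(F;ℚ)`, so both ALLOWABLE, hence Stein with boundary
contact structures supported by the common boundary open book `(F, φ₊)` (AO/LP; the open books of
`∂X₊` and `∂(-X₋)` are the same pages, binding and base orientation — the configuration is still
folded, whence `SameContactOrientation`); `X₊` is a connected 2-handlebody with `d + 1` vanishing
cycles and `χ = 1`, so `H₁(X₊;ℚ) = V / span(Pos₁, η²)` and `X₊` is ℚ-acyclic as soon as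
`Fin.cons η₂ P` is linearly independent: this gives `SortedBisection M` (`W₁ := X₊`, `W₂ := X₋`
with the restricted embeddings, `ob := (F, φ₊)` on a boundary datum of `W₁`);
(iv) stuck clause: append one common positive stabilisation pair `u₁, u₂` along `γ₁` and a
disjoint arc (side 1: `u₁⁺ u₂⁺`; side 2: the same curves, `M`-negative), Hurwitz-tilt `u₁` by `η¹`
on side 1 and `η²` by `u₁` on side 2 (within-side moves: pieces, gluing and common open book
unchanged); the `M`-positive family in `H₁(F';ℚ) = V × ℚ × ℚ` is then `tiltFamily P η₁ η₂ c c'`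
(`d + 3` classes, `dim = d + 3`), and the same sorting realises `SortedBisection M` as soon as it is
linearly independent (the exchange lemma `tilt_linearIndependent` says it is, in the stuck case).
Why it might fail: a sign/count slip in (ii) (which letters are `M`-positive on side 2; the fold)
or in the class formulas of the tilts in (iv) — both re-derived independently by all three triagers
(TRIAGE-r1-1 §headline, r1-2 §hurwitz-tilt (1)–(5), r1-3 derivations); the residual risk named by
the panel is the orientation convention for "`M`-positive" letters of side 2.  Dead lines avoided:
no bypass / dividing-set simplification in `S⁵` (route engine E-b, no technology); no handle is
moved across the fold in the Stein category (Lisca–Matić) — the swap happens in the closed-up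
achiral fibration `Z → S²`.  NOTE: `M ≃ₕ S⁴` is NOT a hypothesis — the statement is about any `M`
carrying such a folded acyclic pair (for ℂP² there is none: Disproof §7). -/
theorem stub_sortDictionary :
    ∀ (M : Type) [TopologicalSpace M] [T2Space M] [SecondCountableTopology M]
      [ChartedSpace (EuclideanSpace ℝ (Fin 4)) M] [IsManifold (𝓡 4) ∞ M]
      (X₁ : Type) [TopologicalSpace X₁] [T2Space X₁] [ChartedSpace (EuclideanHalfSpace 4) X₁]
      [IsManifold (𝓡∂ 4) ∞ X₁] [CompactSpace X₁] [ContractibleSpace X₁]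
      (X₂ : Type) [TopologicalSpace X₂] [T2Space X₂] [ChartedSpace (EuclideanHalfSpace 4) X₂]
      [IsManifold (𝓡∂ 4) ∞ X₂] [CompactSpace X₂] [ConnectedSpace X₂]
      (I₁ : SteinStructure X₁) (I₂ : SteinStructure X₂) (f₁ : X₁ → M) (f₂ : X₂ → M)
      (b : BoundaryData (𝓡∂ 4) X₁ (𝓡 3)),
      IsBisection M X₁ X₂ f₁ f₂ → RatAcyclic X₂ →
      SameSeamOrientation M X₁ X₂ I₁ I₂ f₁ f₂ →
      PlaneFieldsHomotopic (boundaryPlaneField I₁.J b) (seamPlaneField I₂.J f₁ f₂ b) →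
      ∃ (V : Type) (_ : AddCommGroup V) (_ : Module ℚ V) (d : ℕ) (P : Fin d → V) (η₁ η₂ : V)
        (c c' : ℚ),
        LinearIndependent ℚ (Fin.cons η₁ P : Fin (d + 1) → V) ∧
        Submodule.span ℚ (Set.range (Fin.cons η₁ P : Fin (d + 1) → V)) = ⊤ ∧
        c ≠ 0 ∧ c' ≠ 0 ∧
        (LinearIndependent ℚ (Fin.cons η₂ P : Fin (d + 1) → V) → SortedBisection M) ∧
        (LinearIndependent ℚ (tiltFamily P η₁ η₂ c c') → SortedBisection M) := by
  sorry

/-- **stub 4 — Giroux–Torisu uniqueness with Gray stability** (Giroux, ICM 2002; Torisu, IMRN 2000:9;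
Etnyre arXiv:math/0409402 Prop 3.18 (uniqueness half of Thm 3.13) and Lemma 3.3; Gray's theorem,
Geiges 2008 Thm 2.2.2; size L: a 1-parameter family of Giroux forms `α_s` — linear interpolation is
contact after adding `K·f(r)dθ` near the binding / off it — then Gray's Moser argument integrates a
time-dependent vector field on the compact `N`).  Two plane fields supported by the SAME open book
(`IsGirouxForm` for both, with one `ob`) and positive for the SAME orientation are isotopic: there is
a smooth isotopy `F` from the identity with `(F 1)_* ξ = ξ'`.  Why it might fail: only if the
tree's `IsGirouxForm` sign conditions under-determine "supported" (they were checked on the `S³`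
and `S¹ × D²` models in `PlanarContactBoundary.lean`); `SameContactOrientation` excludes the
mirror pair, for which the statement is false. -/
theorem stub_girouxUniqueness :
    ∀ (N : Type) [TopologicalSpace N] [T2Space N] [CompactSpace N]
      [ChartedSpace (EuclideanSpace ℝ (Fin 3)) N] [IsManifold (𝓡 3) ∞ N]
      (ob : OpenBook N) (ξ ξ' : N → Submodule ℝ (EuclideanSpace ℝ (Fin 3)))
      (α α' : Literature.Geometry.Kaehler.MForm (𝓡 3) N ℝ 1),
      ob.IsGirouxForm ξ α → ob.IsGirouxForm ξ' α' → SameContactOrientation α α' →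
      ∃ F : ℝ → N ≃ₘ⟮𝓡 3, 𝓡 3⟯ N, IsSmoothIsotopy F ∧ PushesTo (F 1) ξ ξ' := by
  sorry

/-- **stub 5 — realising a seam isotopy inside the Stein structure of `W₁`** (differential
topology; size M–L: collar theorem for `∂W₁` — the tree's `BoundaryCollar` — isotopy extension
`Φ(x, s) = (ψ_{ρ(s)}⁻¹ x, s)` on the collar, identity inside, and transport of structure: the
pull-back `Φ^*J₁ = (dΦ)⁻¹ ∘ J₁ ∘ dΦ`, `φ₁ ∘ Φ` of a Stein structure along a self-diffeomorphism is a
Stein structure with the same boundary level set, whose complex tangencies at `∂W₁` are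
`(dΦ)⁻¹ ξ₁ = ψ^* ξ₁`).  If a smooth isotopy of the boundary datum `b` of `W₁` carries the
`J₁`-tangencies `ξ₁♭` onto the other side's planes `ξ₂♯` (`seamPlaneField`), then for SOME Stein
structure `J₁'` on the same `W₁` the pushed-forward complex tangencies of `J₁'` and `J₂` agree at
every seam point — the crux's matching conjunct, with `W₁, W₂, e₁, e₂, J₂` untouched (so
acyclicity and the bisection are kept).  This is the "Gray/pointwise packaging" already accepted for
support item `SteinBisectionExists`; no contact geometry is needed beyond the chain rule
(`contactPlane ≤ boundaryTangentSpace`, injectivity of `d(e₁ ∘ b.incl)`). -/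
theorem stub_realiseSeamIsotopy :
    ∀ (M : Type) [TopologicalSpace M] [T2Space M] [SecondCountableTopology M]
      [ChartedSpace (EuclideanSpace ℝ (Fin 4)) M] [IsManifold (𝓡 4) ∞ M]
      (W₁ : Type) [TopologicalSpace W₁] [T2Space W₁] [ChartedSpace (EuclideanHalfSpace 4) W₁]
      [IsManifold (𝓡∂ 4) ∞ W₁] [CompactSpace W₁]
      (W₂ : Type) [TopologicalSpace W₂] [ChartedSpace (EuclideanHalfSpace 4) W₂]
      [IsManifold (𝓡∂ 4) ∞ W₂] [CompactSpace W₂]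
      (J₁ : SteinStructure W₁) (J₂ : SteinStructure W₂) (e₁ : W₁ → M) (e₂ : W₂ → M)
      (b : BoundaryData (𝓡∂ 4) W₁ (𝓡 3)),
      IsBisection M W₁ W₂ e₁ e₂ →
      ∀ F : ℝ → b.carrier ≃ₘ⟮𝓡 3, 𝓡 3⟯ b.carrier, IsSmoothIsotopy F →
        PushesTo (F 1) (boundaryPlaneField J₁.J b) (seamPlaneField J₂.J e₁ e₂ b) →
        ∃ J₁' : SteinStructure W₁, PlanesMatch M W₁ W₂ J₁' J₂ e₁ e₂ := by
  sorry

/-- **stub 6 — homology control on ONE half suffices over a homotopy 4-sphere**, stated over the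
LANDED negative-side vocabulary (`Theorems/AcyclicBisectionExists/Negative/Witness.lean`): this is
literally the disprover's `Witness.acyclicRight_of_acyclicLeft_of_homotopyEquiv'` (Disproof.lean
gen 2 §8–§9, machine-checked there, rc 0; size M as a port: pair sequence of `(M, e₂W₂)`, excision
to `(W₁, ∂W₁)`, Lefschetz duality on the Stein-oriented `W₁`, Hatcher 3.29, plus §9's "connected
acyclic `W₁` ⇒ connected seam ⇒ connected `W₂`").  It closes by `exact` as soon as parts 3–5 of
the Negative split land; until then it is the one stub a prover can discharge today by porting
§8–§9 over `Negative.Witness`.  False without `ConnectedSpace B.W₁` (two acyclic components),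
which is why `SortedBisection` delivers a connected `W₁`; uses `M ≃ₕ S⁴` essentially (ℂP²). -/
theorem stub_acyclicRightOfLeft :
    ∀ (M : Type) [TopologicalSpace M] [T2Space M] [SecondCountableTopology M]
      [ChartedSpace (EuclideanSpace ℝ (Fin 4)) M] [IsManifold (𝓡 4) ∞ M],
      M ≃ₕ Metric.sphere (0 : EuclideanSpace ℝ (Fin 5)) 1 →
      ∀ (B : Theorems.AcyclicBisectionExists.Negative.Witness M) [ConnectedSpace B.W₁],
        B.AcyclicLeft → B.AcyclicRight := by
  sorry

/-! ### The composition -/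

/-- **The line closes the crux**: the six registered stubs imply
`ConvexBisection.AcyclicBisectionExists` (type literally the route decl; the stubs enter BY NAME, as
the skeleton audit requires).  Proof: AM folded pair (`stub_akbulutMatveyevFolded`) → its seam fields
are homotopic (`stub_seamFieldsHomotopic`) → the sorting dictionary (`stub_sortDictionary`) → THE
SWAP: if `Pos₁ ∪ {η²}` is independent, sort (unstuck clause); otherwise one stabilisation pair and
two tilts make `tiltFamily` independent (`tilt_linearIndependent`, kernel-checked) and sort (stuck
clause) — either way a bisection `W₁ ∪ W₂` with `W₁` connected ℚ-acyclic and both seam structures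
positively supported by one open book → Giroux uniqueness gives a seam isotopy
(`stub_girouxUniqueness`) → pulled into `J₁'` so that the planes match pointwise
(`stub_realiseSeamIsotopy`) → `W₂` is ℚ-acyclic by one-sided control on the landed `Witness`
(`stub_acyclicRightOfLeft`) → the crux's witness `(W₁, W₂, J₁', J₂, e₁, e₂)`. -/
theorem AcyclicBisectionExists_of :
    Summit.SmoothPoincare4.SmoothPoincare4.Theses.ConvexBisection.AcyclicBisectionExists := by
  intro M _ _ _ _ _ hM
  -- the folded Akbulut–Matveyev pair of `M`
  obtain ⟨X₁, _, _, _, _, _, _, X₂, _, _, _, _, _, _, I₁, I₂, f₁, f₂, hbis, hac₂, hfold⟩ :=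
    stub_akbulutMatveyevFolded M hM
  -- the boundary datum `∂X₁` of `X₁` and the homotopy of the two seam plane fields on it
  let b : BoundaryData (𝓡∂ 4) X₁ (𝓡 3) := BoundaryManifold.boundaryData 3 X₁
  have hhom := stub_seamFieldsHomotopic M X₁ X₂ I₁ I₂ f₁ f₂ hbis hac₂ hfold b
  -- the dictionary: the linear-algebra shadow of the matched `n = 1` presentation
  obtain ⟨V, _, _, d, P, η₁, η₂, c, c', hbasis, -, hc, hc', hunstuck, hstuck⟩ :=
    stub_sortDictionary M X₁ X₂ I₁ I₂ f₁ f₂ b hbis hac₂ hfold hhom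
  -- THE SWAP: sort at once, or un-stick by one stabilisation pair + two tilts and sort
  have hsorted : SortedBisection M := by
    by_cases h : LinearIndependent ℚ (Fin.cons η₂ P : Fin (d + 1) → V)
    · exact hunstuck h
    · exact hstuck (tilt_linearIndependent P η₁ η₂ c c' hbasis h hc hc')
  obtain ⟨W₁, _, _, _, _, _, _, W₂, _, _, _, _, J₁, J₂, e₁, e₂, b', ob, α₁, α₂, hbis', hacW₁, hG₁,
    hG₂, hsign⟩ := hsorted
  -- Giroux uniqueness on the compact Hausdorff boundary 3-manifold `b'.carrier`
  haveI : T2Space b'.carrier := b'.isSmoothEmbedding.isEmbedding.t2Space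
  haveI : IsManifold (𝓡∂ 4) 1 W₁ := IsManifold.of_le (n := ∞) (by norm_num)
  haveI : CompactSpace b'.carrier := b'.compactSpace_carrier
  obtain ⟨F, hF, hpush⟩ := stub_girouxUniqueness b'.carrier ob _ _ α₁ α₂ hG₁ hG₂ hsign
  -- absorb the isotopy into the Stein structure of `W₁`
  obtain ⟨J₁', hmatch⟩ := stub_realiseSeamIsotopy M W₁ W₂ J₁ J₂ e₁ e₂ b' hbis' F hF hpush
  -- one-sided homology control, on the landed `Witness` packaging of `(W₁, W₂, J₁', J₂, e₁, e₂)`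
  obtain ⟨h₁, h₂, h₃, h₄, h₅⟩ := hbis'
  have hacW₂ : RatAcyclic W₂ :=
    @stub_acyclicRightOfLeft M _ _ _ _ _ hM
      (⟨W₁, W₂, J₁', J₂, e₁, e₂, h₁, h₂, h₃, h₄, h₅, hmatch⟩ :
        Theorems.AcyclicBisectionExists.Negative.Witness M) ‹ConnectedSpace W₁› hacW₁
  exact ⟨W₁, _, _, _, _, W₂, _, _, _, _, J₁', J₂, e₁, e₂, h₁, h₂, h₃, h₄, h₅, hmatch,
    fun k hk => ⟨hacW₁ k hk, hacW₂ k hk⟩⟩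

end Summit.SmoothPoincare4.SmoothPoincare4.Cruxes.AcyclicBisectionExists.AchiralSwap

end
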